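import Mathlib
import Summits.Ventures.PercRepro2.ZeroEdges
import Summits.Ventures.PercRepro2.PendantRoot
import Summits.Ventures.PercRepro2.PendantEdm
import Summits.Ventures.PercRepro2.SeriesPin
import Summits.Ventures.PercRepro2.HMFLeafInvisible

/-!
# Two edges in series at a vertex of degree two: connection events (blind cell PercRepro2,
night-1 g14; NIGHT1-G14.md §14)

Let `v` carry exactly the two edges `f = {v, w}` and `f' = {v, w'}`.  With `f'` at weight `0` the
edge `f` is invisible to every connection event among vertices other than `v` (`prob_conn_update_of_closed`:
the weight-`0` edge is deleted by `ZeroEdges`, `v` becomes a structural leaf of the remaining graph,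
and the leaf edge is free — `PendantRoot.free_connEvent`).  Hence, by the pinning identity
`SeriesPin.prob_series`, such an event sees the two weights only through their product
(`prob_conn_series`): `P_p(x ↔ y) = P_{p[f ↦ p f · p f', f' ↦ 1]}(x ↔ y)`.
-/

namespace Summit.Ventures.PercRepro2

namespace SeriesPin

open UnionCluster CovForm

section Conn

variable {V : Type*} {E : Type*} [Fintype E] [DecidableEq E] {R : Type*} [Field R]

omit [Fintype E] [Field R] in
/-- Restricting the weights after an update on a kept edge is the update of the restriction. -/
lemma pR_update {keep : E → Prop} [DecidablePred keep] (q : E → R) {f : E} (hf : keep f) (c : R) :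
    ZeroEdges.pR keep (Function.update q f c) = Function.update (ZeroEdges.pR keep q) ⟨f, hf⟩ c := by
  funext e
  simp only [ZeroEdges.pR, Function.update]
  by_cases h : e = ⟨f, hf⟩
  · subst h; simp
  · have h' : (e : E) ≠ f := fun h'' => h (Subtype.ext h'')
    simp [h, h']

/-- With `f'` closed (weight `0`), the other edge `f = {v, w}` of the degree-two vertex `v` is
invisible to the connection events among vertices other than `v`. -/
lemma prob_conn_update_of_closed (p : E → R) (ends : E → Sym2 V) {f f' : E} (hff : f ≠ f')
    {v w : V} (hf : ends f = s(v, w)) (hdeg : ∀ e, v ∈ ends e → e = f ∨ e = f') (hvw : v ≠ w)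
    {x y : V} (hx : x ≠ v) (hy : y ≠ v) (c : R) :
    prob (Function.update (Function.update p f' 0) f c) (connEvent ends x y) =
      prob (Function.update p f' 0) (connEvent ends x y) := by
  classical
  set keep : E → Prop := fun e => e ≠ f' with hkeep
  have h0 : ∀ e, ¬ keep e → (Function.update p f' 0) e = 0 := by
    intro e he
    rw [hkeep] at he
    simp only [not_not] at he
    rw [he, Function.update_self]
  have h0' : ∀ e, ¬ keep e → (Function.update (Function.update p f' 0) f c) e = 0 := by
    intro e he
    have he' : e = f' := by rw [hkeep] at he; simpa using he
    rw [he', Function.update_of_ne hff.symm, Function.update_self]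
  rw [ZeroEdges.prob_ext _ h0', ZeroEdges.prob_ext _ h0, ZeroEdges.preimage_connEvent]
  have hfk : keep f := hff
  rw [pR_update (Function.update p f' 0) hfk c]
  -- in the kept graph `v` is a structural leaf with the edge `⟨f, _⟩`
  have hleaf : ∀ e : {e // keep e}, v ∈ ZeroEdges.endsR keep ends e → e = ⟨f, hfk⟩ := by
    rintro ⟨e, he⟩ hv
    rcases hdeg e hv with h | h
    · exact Subtype.ext h
    · exact absurd h he
  have hfree : PendantRoot.Free (⟨f, hfk⟩ : {e // keep e})
      (connEvent (ZeroEdges.endsR keep ends) x y) :=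
    PendantRoot.free_connEvent (ends := ZeroEdges.endsR keep ends) (f := ⟨f, hfk⟩) (a₃ := v) (a₂ := w)
      hf hleaf hvw hx hy
  exact PendantEdm.prob_update_of_free _ hfree c

/-- **Connection events see two edges in series only through the product of their weights.**
`v` carries exactly `f = {v, w}` and `f' = {v, w'}`; for `x, y ≠ v`:
`P_p(x ↔ y) = P_{p[f ↦ p f · p f', f' ↦ 1]}(x ↔ y)`. -/
theorem prob_conn_series (p : E → R) (ends : E → Sym2 V) {f f' : E} (hff : f ≠ f') {v w w' : V}
    (hf : ends f = s(v, w)) (hf' : ends f' = s(v, w')) (hdeg : ∀ e, v ∈ ends e → e = f ∨ e = f')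
    (hvw : v ≠ w) (hvw' : v ≠ w') {x y : V} (hx : x ≠ v) (hy : y ≠ v) :
    prob p (connEvent ends x y) =
      prob (Function.update (Function.update p f (p f * p f')) f' 1) (connEvent ends x y) := by
  refine prob_series p hff (connEvent ends x y) ?_ ?_
  · rw [prob_conn_update_of_closed p ends hff hf hdeg hvw hx hy 1,
      prob_conn_update_of_closed p ends hff hf hdeg hvw hx hy 0]
  · have hdeg' : ∀ e, v ∈ ends e → e = f' ∨ e = f := fun e he => (hdeg e he).symm
    rw [prob_conn_update_of_closed p ends hff.symm hf' hdeg' hvw' hx hy 1,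
      prob_conn_update_of_closed p ends hff.symm hf' hdeg' hvw' hx hy 0]


/-- **The series identity for any event free of the closed-off edge in both restricted graphs.**
`v` carries exactly `f` and `f'`; if `A` (transported to the graph without `f'`) is free of `f` and
(transported to the graph without `f`) is free of `f'`, then `A` sees the two weights only through
their product. -/
theorem prob_series_of_free (p : E → R) {f f' : E} (hff : f ≠ f') (A : Set (Config E))
    (hA1 : PendantRoot.Free (⟨f, hff⟩ : {e // e ≠ f'}) (ZeroEdges.ext (fun e => e ≠ f') ⁻¹' A))
    (hA2 : PendantRoot.Free (⟨f', hff.symm⟩ : {e // e ≠ f}) (ZeroEdges.ext (fun e => e ≠ f) ⁻¹' A)) :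
    prob p A = prob (Function.update (Function.update p f (p f * p f')) f' 1) A := by
  classical
  refine prob_series p hff A ?_ ?_
  · have h0 : ∀ e, ¬ (e ≠ f') → (Function.update p f' 0) e = 0 := by
      intro e he
      rw [not_not.1 he, Function.update_self]
    have h1 : ∀ e, ¬ (e ≠ f') → (Function.update (Function.update p f' 0) f 1) e = 0 := by
      intro e he
      rw [not_not.1 he, Function.update_of_ne hff.symm, Function.update_self]
    have h1' : ∀ e, ¬ (e ≠ f') → (Function.update (Function.update p f' 0) f 0) e = 0 := by
      intro e he
      rw [not_not.1 he, Function.update_of_ne hff.symm, Function.update_self]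
    rw [ZeroEdges.prob_ext _ h1, ZeroEdges.prob_ext _ h1',
      pR_update (keep := fun e => e ≠ f') (Function.update p f' 0) hff 1,
      pR_update (keep := fun e => e ≠ f') (Function.update p f' 0) hff 0,
      PendantEdm.prob_update_of_free _ hA1, PendantEdm.prob_update_of_free _ hA1]
  · have h1 : ∀ e, ¬ (e ≠ f) → (Function.update (Function.update p f 0) f' 1) e = 0 := by
      intro e he
      rw [not_not.1 he, Function.update_of_ne hff, Function.update_self]
    have h1' : ∀ e, ¬ (e ≠ f) → (Function.update (Function.update p f 0) f' 0) e = 0 := by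
      intro e he
      rw [not_not.1 he, Function.update_of_ne hff, Function.update_self]
    rw [ZeroEdges.prob_ext _ h1, ZeroEdges.prob_ext _ h1',
      pR_update (keep := fun e => e ≠ f) (Function.update p f 0) hff.symm 1,
      pR_update (keep := fun e => e ≠ f) (Function.update p f 0) hff.symm 0,
      PendantEdm.prob_update_of_free _ hA2, PendantEdm.prob_update_of_free _ hA2]

omit [Fintype E] in
/-- In the graph without `f'`, the vertex `v` (edges exactly `f = {v, w}`, `f'`) is a leaf, so a
connection event among vertices other than `v` is free of `f`. -/
lemma free_restrict_conn (ends : E → Sym2 V) {f f' : E} (hff : f ≠ f') {v w : V}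
    (hf : ends f = s(v, w)) (hdeg : ∀ e, v ∈ ends e → e = f ∨ e = f') (hvw : v ≠ w)
    {x y : V} (hx : x ≠ v) (hy : y ≠ v) :
    PendantRoot.Free (⟨f, hff⟩ : {e // e ≠ f'})
      (ZeroEdges.ext (fun e => e ≠ f') ⁻¹' connEvent ends x y) := by
  classical
  rw [ZeroEdges.preimage_connEvent]
  have hleaf : ∀ e : {e // e ≠ f'}, v ∈ ZeroEdges.endsR (fun e => e ≠ f') ends e → e = ⟨f, hff⟩ := by
    rintro ⟨e, he⟩ hv
    rcases hdeg e hv with h | h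
    · exact Subtype.ext h
    · exact absurd h he
  exact PendantRoot.free_connEvent (ends := ZeroEdges.endsR (fun e => e ≠ f') ends) (f := ⟨f, hff⟩)
    (a₃ := v) (a₂ := w) hf hleaf hvw hx hy

omit [Fintype E] in
/-- The restricted form of `free_restrict_conn`: in the graph without `f'`, a connection event among
vertices other than the degree-two vertex `v` is free of `⟨f, _⟩`. -/
lemma free_conn_R (ends : E → Sym2 V) {f f' : E} (hff : f ≠ f') {v w : V}
    (hf : ends f = s(v, w)) (hdeg : ∀ e, v ∈ ends e → e = f ∨ e = f') (hvw : v ≠ w)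
    {x y : V} (hx : x ≠ v) (hy : y ≠ v) :
    PendantRoot.Free (⟨f, hff⟩ : {e // e ≠ f'})
      (connEvent (ZeroEdges.endsR (fun e => e ≠ f') ends) x y) := by
  have h := free_restrict_conn ends hff hf hdeg hvw hx hy
  rwa [ZeroEdges.preimage_connEvent] at h

omit [Fintype E] in
/-- `Q = {a₁ ↮ a₂}` transported to the graph without `f'` is free of `⟨f, _⟩`. -/
lemma free_restrict_avoid (ends : E → Sym2 V) {f f' : E} (hff : f ≠ f') {v w : V}
    (hf : ends f = s(v, w)) (hdeg : ∀ e, v ∈ ends e → e = f ∨ e = f') (hvw : v ≠ w)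
    {a₁ a₂ : V} (h1 : a₁ ≠ v) (h2 : a₂ ≠ v) :
    PendantRoot.Free (⟨f, hff⟩ : {e // e ≠ f'})
      (ZeroEdges.ext (fun e => e ≠ f') ⁻¹' avoidAll ends a₂ {a₁}) := by
  rw [ZeroEdges.preimage_avoidAll, PendantRoot.avoidAll_eq_compl]
  exact (free_conn_R ends hff hf hdeg hvw h1 h2).compl

omit [Fintype E] in
/-- `PD` transported to the graph without `f'` is free of `⟨f, _⟩`. -/
lemma free_restrict_PD (ends : E → Sym2 V) {f f' : E} (hff : f ≠ f') {v w : V}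
    (hf : ends f = s(v, w)) (hdeg : ∀ e, v ∈ ends e → e = f ∨ e = f') (hvw : v ≠ w)
    {a₁ a₂ a₃ : V} (h1 : a₁ ≠ v) (h2 : a₂ ≠ v) (h3 : a₃ ≠ v) :
    PendantRoot.Free (⟨f, hff⟩ : {e // e ≠ f'})
      (ZeroEdges.ext (fun e => e ≠ f') ⁻¹' PDEvent ends a₁ a₂ a₃) := by
  rw [ZeroEdges.preimage_PDEvent]
  unfold PDEvent Dtilde UnionCluster.inU
  exact (free_conn_R ends hff hf hdeg hvw h1 h2).compl.inter
    (HMFLeafInvisible.free_union (free_conn_R ends hff hf hdeg hvw h3 h1)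
      (free_conn_R ends hff hf hdeg hvw h3 h2)).compl

omit [Fintype E] in
/-- `T` transported to the graph without `f'` is free of `⟨f, _⟩`. -/
lemma free_restrict_T (ends : E → Sym2 V) {f f' : E} (hff : f ≠ f') {v w : V}
    (hf : ends f = s(v, w)) (hdeg : ∀ e, v ∈ ends e → e = f ∨ e = f') (hvw : v ≠ w)
    {a₁ a₂ a₃ : V} (h1 : a₁ ≠ v) (h2 : a₂ ≠ v) (h3 : a₃ ≠ v) :
    PendantRoot.Free (⟨f, hff⟩ : {e // e ≠ f'})
      (ZeroEdges.ext (fun e => e ≠ f') ⁻¹' TEvent ends a₁ a₂ a₃) := by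
  rw [ZeroEdges.preimage_TEvent]
  unfold TEvent
  exact (free_conn_R ends hff hf hdeg hvw h2 h1).compl.inter (free_conn_R ends hff hf hdeg hvw h2 h3)

/-- **`Q` sees two edges in series only through the product of their weights.** -/
theorem prob_avoid_series (p : E → R) (ends : E → Sym2 V) {f f' : E} (hff : f ≠ f') {v w w' : V}
    (hf : ends f = s(v, w)) (hf' : ends f' = s(v, w')) (hdeg : ∀ e, v ∈ ends e → e = f ∨ e = f')
    (hvw : v ≠ w) (hvw' : v ≠ w') {a₁ a₂ : V} (h1 : a₁ ≠ v) (h2 : a₂ ≠ v) :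
    prob p (avoidAll ends a₂ {a₁}) =
      prob (Function.update (Function.update p f (p f * p f')) f' 1) (avoidAll ends a₂ {a₁}) :=
  prob_series_of_free p hff _ (free_restrict_avoid ends hff hf hdeg hvw h1 h2)
    (free_restrict_avoid ends hff.symm hf' (fun e he => (hdeg e he).symm) hvw' h1 h2)

/-- **`Q ∩ {x ↔ y}` sees two edges in series only through the product of their weights.** -/
theorem prob_avoid_conn_series (p : E → R) (ends : E → Sym2 V) {f f' : E} (hff : f ≠ f')
    {v w w' : V} (hf : ends f = s(v, w)) (hf' : ends f' = s(v, w'))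
    (hdeg : ∀ e, v ∈ ends e → e = f ∨ e = f') (hvw : v ≠ w) (hvw' : v ≠ w') {a₁ a₂ x y : V}
    (h1 : a₁ ≠ v) (h2 : a₂ ≠ v) (hx : x ≠ v) (hy : y ≠ v) :
    prob p (avoidAll ends a₂ {a₁} ∩ connEvent ends x y) =
      prob (Function.update (Function.update p f (p f * p f')) f' 1)
        (avoidAll ends a₂ {a₁} ∩ connEvent ends x y) :=
  prob_series_of_free p hff _
    (by rw [Set.preimage_inter]
        exact (free_restrict_avoid ends hff hf hdeg hvw h1 h2).inter
          (free_restrict_conn ends hff hf hdeg hvw hx hy))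
    (by rw [Set.preimage_inter]
        exact (free_restrict_avoid ends hff.symm hf' (fun e he => (hdeg e he).symm) hvw' h1 h2).inter
          (free_restrict_conn ends hff.symm hf' (fun e he => (hdeg e he).symm) hvw' hx hy))

/-- **`PD` sees two edges in series only through the product of their weights.** -/
theorem prob_PD_series (p : E → R) (ends : E → Sym2 V) {f f' : E} (hff : f ≠ f') {v w w' : V}
    (hf : ends f = s(v, w)) (hf' : ends f' = s(v, w')) (hdeg : ∀ e, v ∈ ends e → e = f ∨ e = f')
    (hvw : v ≠ w) (hvw' : v ≠ w') {a₁ a₂ a₃ : V} (h1 : a₁ ≠ v) (h2 : a₂ ≠ v) (h3 : a₃ ≠ v) :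
    prob p (PDEvent ends a₁ a₂ a₃) =
      prob (Function.update (Function.update p f (p f * p f')) f' 1) (PDEvent ends a₁ a₂ a₃) :=
  prob_series_of_free p hff _ (free_restrict_PD ends hff hf hdeg hvw h1 h2 h3)
    (free_restrict_PD ends hff.symm hf' (fun e he => (hdeg e he).symm) hvw' h1 h2 h3)

/-- **`T` sees two edges in series only through the product of their weights.** -/
theorem prob_T_series (p : E → R) (ends : E → Sym2 V) {f f' : E} (hff : f ≠ f') {v w w' : V}
    (hf : ends f = s(v, w)) (hf' : ends f' = s(v, w')) (hdeg : ∀ e, v ∈ ends e → e = f ∨ e = f')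
    (hvw : v ≠ w) (hvw' : v ≠ w') {a₁ a₂ a₃ : V} (h1 : a₁ ≠ v) (h2 : a₂ ≠ v) (h3 : a₃ ≠ v) :
    prob p (TEvent ends a₁ a₂ a₃) =
      prob (Function.update (Function.update p f (p f * p f')) f' 1) (TEvent ends a₁ a₂ a₃) :=
  prob_series_of_free p hff _ (free_restrict_T ends hff hf hdeg hvw h1 h2 h3)
    (free_restrict_T ends hff.symm hf' (fun e he => (hdeg e he).symm) hvw' h1 h2 h3)

end Conn

end SeriesPin

end Summit.Ventures.PercRepro2
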